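import Summits.HodgeConjecture.CorCM.AndrePolarizedFormHolds
import Literature.AlgebraicGeometry.HodgeTheory.KodairaEmbeddingHyperplaneClass
import Literature.AlgebraicGeometry.Andre1996.WeilClassesAlgebraicallyAnchoredPencil
import Literature.AlgebraicGeometry.Andre1996.CMHodgeClassesEllipticPowerPencils
import HarnessLib

/-!
# Road b02 (`VHCAbelianSchemesRoad`), binder #22 — the ROUTE-FREE twin of the Kodaira ∧ Lemme-6.3.3 glue (for the gate's `--glue-by`)

research route conditional on HC_CM; not a corollary; Q11.4-sentence-2 already refuted in dim ≥ 3.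

THEOREMS ONLY (zero new mathematics; 0 def, 0 sorry). `Theorems/VHCAbelianSchemesRoadAndreAnchoredPencilsAlgebraic.lean` (p529100, seat
`pub-hodge-ring2-andre-pencil-p1`) proves `Kodaira1954_rationalKaehlerClass_eq_hyperplaneClass → andre1996_splitWeilClasses_algebraicallyAnchoredPencil →
andre1996_cmHodgeClasses_algebraicallyAnchoredPencils` (§1–§2 there) but IMPORTS the route file `Theses.VHCAbelianSchemesRoad`, so the gate cannot use
its theorem as the `--glue-by` of the item-level split of `AndreAnchoredPencilsAlgebraic` (stmt-HodgeConjecture-19784) — the re-rendered route file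
would import itself (ring2 LEAD gen 155 SPLIT RESULT, HOME INBOX l.5076; director-hodge g8 l.5077 side-file request to this seat). This module
re-proves the two steps, INLINED into one theorem with the hypotheses in the order (Lemme 6.3.3, Kodaira) — the gate's dedup lint refuses a
verbatim restatement of p529100's `Kodaira → 6.3.3 → #22`, so the split's children must be listed as `[AndreSplitWeilPencilsAnchored,
KodairaHyperplaneClass]` — under the fresh sub-namespace `…Theorems.AndreKodairaGlue`, importing ONLY Literature and the CorCM kernel module
(`Summits.HodgeConjecture.CorCM.AndrePolarizedFormHolds`) — NO `Theses.*` import — and concludes the DEFINIENS of the route decl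
(`Literature.AlgebraicGeometry.Andre1996.andre1996_cmHodgeClasses_algebraicallyAnchoredPencils`), so that
`Theses.VHCAbelianSchemesRoad.AndreAnchoredPencilsAlgebraic` follows by unfolding on the route side. Nothing here proves #22, Lemme 6.3.3,
Kodaira's theorem, `HC_CM`, `HC_AV` or HC. References: [cite: Andre1996Motifs, §6.3 Lemme 6.3.2 (p. 32), Lemme 6.3.3 and proof (p. 33)]
[cite: Andre1992HodgeCM, Théorème] [cite: Deligne1982HodgeCycles, §4 Thm. 4.8 (a)–(b), Cor. 4.2] [cite: Huybrechts2005, Prop. 5.3.1, Cor. 5.3.3]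
[cite: VoisinHodgeI2002, Thm. 7.10, Thm. 7.11].
-/

noncomputable section

open CategoryTheory

namespace Summit.HodgeConjecture.HodgeConjecture.Theorems.AndreKodairaGlue

-- the cell's namespace repeats the summit name (`Summit.HodgeConjecture.HodgeConjecture…`), as in every road file
set_option linter.dupNamespace false

open Literature.AlgebraicGeometry Literature.AlgebraicGeometry.Motives
open Literature.AlgebraicGeometry.HodgeTheory
open Literature.AlgebraicTopology.SingularHomology
open Literature.AlgebraicGeometry.VanGeemen1994 (pullbackOne)
open Literature.AlgebraicGeometry.Andre1996 (andre1996_cmHodgeClasses_algebraicallyAnchoredPencils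
  andre1996_splitWeilClasses_algebraicallyAnchoredPencil)
open Summit.HodgeConjecture.CorCM.AndreSplit
  (andre1992_hodgeClasses_cmType_mem_span_pullback_polarizedHyperbolicWeilClassesCM_holds)

/-- **#22 ⟸ Lemme 6.3.3 alone ∧ Kodaira, ROUTE-FREE, hypotheses in the order (6.3.3, Kodaira)** — the `--glue-by` decl for the gate's
item-level split of `AndreAnchoredPencilsAlgebraic` with children listed as `[AndreSplitWeilPencilsAnchored, KodairaHyperplaneClass]`
(this order, not the reverse: the curried type `6.3.3 → Kodaira → #22` is deliberately NOT the landed p529100 type `Kodaira → 6.3.3 → #22`,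
which this module cannot import — route cycle — and may not restate verbatim — gate dedup). Proof = p529100 §1–§2 inlined: André 1992
(= Lemme 6.3.2) from the CorCM kernel theorem writes a rational `(p,p)` class on a CM abelian variety in the span of pull-backs of Weil classes
of polarized hyperbolic split CM-field data; Kodaira converts each polarization class into the hyperplane class `e^*a` of a projective
embedding (Rosati-compatible, split); Lemme 6.3.3 alone anchors each such `(B', w)`; the span is monotone. Conclusion = the DEFINIENS of the
route decl (`Literature.AlgebraicGeometry.Andre1996.andre1996_cmHodgeClasses_algebraicallyAnchoredPencils`). Zero new mathematics.
[cite: Andre1996Motifs, §6.3 Lemme 6.3.2 (p. 32) and Lemme 6.3.3 (p. 33)] [cite: Andre1992HodgeCM, Théorème]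
[cite: Deligne1982HodgeCycles, §4 Thm. 4.8 (a)–(b), Cor. 4.2] [cite: Huybrechts2005, Prop. 5.3.1, Cor. 5.3.3] [cite: VoisinHodgeI2002, Thm. 7.11] -/
theorem andreAnchoredPencilsAlgebraic_of_splitWeilPencil_of_kodaira_routeFree
    (h633 : andre1996_splitWeilClasses_algebraicallyAnchoredPencil)
    (hK : Kodaira1954_rationalKaehlerClass_eq_hyperplaneClass) :
    andre1996_cmHodgeClasses_algebraicallyAnchoredPencils := by
  intro B _ hCM p hp c hc hpp
  obtain ⟨R, e₀, -, hspan⟩ :=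
    andre1992_hodgeClasses_cmType_mem_span_pullback_polarizedHyperbolicWeilClassesCM_holds B hCM
  refine Submodule.span_mono ?_ (hspan p (by omega) c hc hpp)
  rintro _ ⟨B', g, η, w, -, hP, hw, hwQ, -, rfl⟩
  -- Kodaira: the polarization class of the datum is the hyperplane class of a projective embedding
  obtain ⟨hW, h, hpol, hKm, hros, -, hhyp⟩ := hP
  have hd : 0 < B'.dim := by have := hW.two_le_dim; omega
  obtain ⟨e, a, ha, ha0, hea⟩ :=
    hK (AbelianVariety.isSmoothProjective_holds (A := B')) hd h hpol.isRationalClass hKm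
  rw [← hea] at hros hhyp
  -- Lemme 6.3.3 alone anchors `(B', w)`
  obtain ⟨𝒳, S, f, hf⟩ := h633.single hW hp ha ha0 hros hhyp hw hwQ
  exact ⟨B', g, w, B'.dim, 𝒳, S, f, hf, rfl⟩

end Summit.HodgeConjecture.HodgeConjecture.Theorems.AndreKodairaGlue

end
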